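import Summits.ValiantsHypothesis.ValiantsHypothesis.Theorems.KPlusLogSqLawOctaveScalesClusters

/-!
# Route «KPlusLogSqLaw», octave door — CONDITIONED PERTURBATION of a lacunary pencil (rung R2 of line «conditioning»)

HONEST FRAMING.  Ideator seat val-idea-1 (g3), `--supports stmt-ValiantsHypothesis-19561` (line «conditioning»,
`Cruxes/WeakLifting/Lines/conditioning.lean`, stub R2 `ConditionedPerturbation`).  A RUNG, not the law: every symmetric letter tuple
with entry scales `ρ_l` admits a symmetric diagonal shift `S_l + ε_l ρ_l • 1`, `0 ≤ ε_l ≤ 2^{-P}`, after which every letter carries a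
two-sided sup-norm conditioning certificate of depth `W = m(P + ⌊log₂ m⌋ + 8)` and the pencil determinant is a nonzero polynomial.
Mechanism: the `m`-th forward difference of the monic `ε ↦ det(T + ε•1)` on the grid `{0, h, …, m h}` equals `m! h^m`
(`Polynomial.fwdDiff_iter_degree_eq_factorial`), so one grid point has `|det| ≥ m! h^m / 2^m`; the adjugate identity turns a determinant
lower bound into a norm lower bound; the top exponent dominates at a large real point, so the determinant polynomial does not vanish.
Nothing about Ω-W / WeakLifting / Conjecture B is claimed; VP ≠ VNP is not moved.

This file: `exists_nat_le_eval_of_monic`, `norm_mulVec_le_of_entry_le`, `exists_shift_det_ge`, `condCert_of_det_ge`, `condPert_arith`,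
`pencilDet_ne_zero_of_condCert`, `conditionedPerturbation` (statement of stub R2 verbatim after unfolding `IsEntryScale` / `CondLE`).
-/

set_option linter.dupNamespace false
set_option autoImplicit false

namespace Summit.ValiantsHypothesis.ValiantsHypothesis.Theorems.KPlusLogSqLaw.Octave

open Polynomial Finset Matrix
open scoped BigOperators

section ConditionedPerturbation

/-- **grid lower bound for monic polynomials**: a monic real polynomial of degree `n` takes a value of absolute size at least
`n!/2^n` at one of the integers `0, 1, …, n` (the `n`-th forward difference there equals `n!`). [folklore] -/
theorem exists_nat_le_eval_of_monic (p : ℝ[X]) (hp : p.Monic) :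
    ∃ k : ℕ, k ≤ p.natDegree ∧ (p.natDegree.factorial : ℝ) / 2 ^ p.natDegree ≤ |p.eval (k : ℝ)| := by
  classical
  by_contra hcon
  push Not at hcon
  have h1 := congrFun (Polynomial.fwdDiff_iter_degree_eq_factorial p) 0
  rw [fwdDiff_iter_eq_sum_shift, Pi.smul_apply, hp.leadingCoeff, one_smul, Pi.natCast_apply] at h1
  have h1' : ∑ k ∈ range (p.natDegree + 1),
      ((-1 : ℝ) ^ (p.natDegree - k) * (p.natDegree.choose k : ℝ)) * p.eval (k : ℝ) = (p.natDegree.factorial : ℝ) := by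
    rw [← h1]
    refine Finset.sum_congr rfl fun k _ => ?_
    simp only [zsmul_eq_mul, zero_add, nsmul_eq_mul, mul_one, Int.cast_mul, Int.cast_pow, Int.cast_neg, Int.cast_one,
      Int.cast_natCast]
  have hlt : |∑ k ∈ range (p.natDegree + 1),
      ((-1 : ℝ) ^ (p.natDegree - k) * (p.natDegree.choose k : ℝ)) * p.eval (k : ℝ)| < (p.natDegree.factorial : ℝ) := by
    calc |∑ k ∈ range (p.natDegree + 1), ((-1 : ℝ) ^ (p.natDegree - k) * (p.natDegree.choose k : ℝ)) * p.eval (k : ℝ)|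
        ≤ ∑ k ∈ range (p.natDegree + 1), |((-1 : ℝ) ^ (p.natDegree - k) * (p.natDegree.choose k : ℝ)) * p.eval (k : ℝ)| :=
          Finset.abs_sum_le_sum_abs _ _
      _ = ∑ k ∈ range (p.natDegree + 1), (p.natDegree.choose k : ℝ) * |p.eval (k : ℝ)| := by
          refine Finset.sum_congr rfl fun k _ => ?_
          rw [abs_mul, abs_mul, abs_pow, abs_neg, abs_one, one_pow, one_mul, Nat.abs_cast]
      _ < ∑ k ∈ range (p.natDegree + 1), (p.natDegree.choose k : ℝ) * ((p.natDegree.factorial : ℝ) / 2 ^ p.natDegree) := by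
          apply Finset.sum_lt_sum
          · intro k hk
            exact mul_le_mul_of_nonneg_left (hcon k (Nat.lt_succ_iff.mp (mem_range.mp hk))).le (Nat.cast_nonneg _)
          · refine ⟨p.natDegree, mem_range.mpr (Nat.lt_succ_self _), ?_⟩
            exact mul_lt_mul_of_pos_left (hcon _ le_rfl) (by exact_mod_cast Nat.choose_pos le_rfl)
      _ = (p.natDegree.factorial : ℝ) := by
          rw [← Finset.sum_mul]
          have h2 : ∑ k ∈ range (p.natDegree + 1), (p.natDegree.choose k : ℝ) = 2 ^ p.natDegree := by
            exact_mod_cast Nat.sum_range_choose p.natDegree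
          rw [h2]
          field_simp
  rw [h1', abs_of_nonneg (Nat.cast_nonneg _)] at hlt
  exact lt_irrefl _ hlt

/-- sup-norm bound for `A v` from an entry bound. [folklore] -/
theorem norm_mulVec_le_of_entry_le {m : ℕ} (A : Matrix (Fin m) (Fin m) ℝ) {b : ℝ} (hb : 0 ≤ b)
    (hA : ∀ i j, |A i j| ≤ b) (v : Fin m → ℝ) : ‖A *ᵥ v‖ ≤ (m : ℝ) * b * ‖v‖ := by
  refine (pi_norm_le_iff_of_nonneg (by positivity)).2 fun i => ?_
  rw [Real.norm_eq_abs]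
  change |∑ j, A i j * v j| ≤ _
  calc |∑ j, A i j * v j| ≤ ∑ j, |A i j * v j| := Finset.abs_sum_le_sum_abs _ _
    _ ≤ ∑ _j : Fin m, b * ‖v‖ := Finset.sum_le_sum fun j _ => by
        rw [abs_mul]
        exact mul_le_mul (hA i j) (by rw [← Real.norm_eq_abs]; exact norm_le_pi_norm v j) (abs_nonneg _) hb
    _ = (m : ℝ) * b * ‖v‖ := by rw [Finset.sum_const, card_univ, Fintype.card_fin, nsmul_eq_mul, mul_assoc]

/-- **the grid shift**: for `m ≥ 1` and any `T`, some diagonal shift `ε ∈ {0, h, …, m h}`, `h = 1/(m 2^P)`, has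
`|det(T + ε•1)| ≥ h^m · m!/2^m`. [folklore] -/
theorem exists_shift_det_ge {m : ℕ} (hm : 0 < m) (P : ℕ) (T : Matrix (Fin m) (Fin m) ℝ) :
    ∃ ε : ℝ, 0 ≤ ε ∧ (2 : ℝ) ^ P * ε ≤ 1 ∧
      (((m : ℝ) * 2 ^ P)⁻¹) ^ m * ((m.factorial : ℝ) / 2 ^ m) ≤ |Matrix.det (T + ε • (1 : Matrix (Fin m) (Fin m) ℝ))| := by
  classical
  set h : ℝ := ((m : ℝ) * 2 ^ P)⁻¹ with hh
  have hmpos : (0 : ℝ) < m := by exact_mod_cast hm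
  have hhpos : 0 < h := by rw [hh]; positivity
  set M : Matrix (Fin m) (Fin m) ℝ := -(h⁻¹ • T) with hM
  obtain ⟨k, hk, hpk⟩ := exists_nat_le_eval_of_monic M.charpoly (Matrix.charpoly_monic M)
  rw [Matrix.charpoly_natDegree_eq_dim, Fintype.card_fin] at hk hpk
  refine ⟨k * h, by positivity, ?_, ?_⟩
  · have hk' : (k : ℝ) ≤ m := by exact_mod_cast hk
    have : (2 : ℝ) ^ P * (k * h) = k / m := by
      rw [hh]
      field_simp
    rw [this]
    exact (div_le_one hmpos).mpr hk'
  · have hmat : T + (k * h) • (1 : Matrix (Fin m) (Fin m) ℝ) = h • ((Matrix.scalar (Fin m)) (k : ℝ) - M) := by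
      ext i j
      simp only [hM, Matrix.scalar_apply, Matrix.add_apply, Matrix.smul_apply, Matrix.sub_apply, Matrix.neg_apply,
        Matrix.diagonal_apply, Matrix.one_apply, smul_eq_mul]
      have hne : h ≠ 0 := hhpos.ne'
      split_ifs <;> field_simp <;> ring
    rw [hmat, Matrix.det_smul, Fintype.card_fin, ← Matrix.eval_charpoly, abs_mul, abs_pow, abs_of_pos hhpos]
    exact mul_le_mul_of_nonneg_left hpk (by positivity)

/-- **conditioning certificate from a determinant lower bound** (adjugate identity): entries `≤ 2` and
`2 m² m! 2^m ≤ 2^W |det T|` give `a > 0` with `a‖v‖ ≤ ‖T v‖ ≤ 2^W a‖v‖`. [folklore] -/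
theorem condCert_of_det_ge {m : ℕ} (hm : 0 < m) (T : Matrix (Fin m) (Fin m) ℝ) (hT : ∀ i j, |T i j| ≤ 2) (W : ℕ)
    (hdet : 2 * (m : ℝ) ^ 2 * m.factorial * 2 ^ m ≤ 2 ^ W * |T.det|) :
    ∃ a : ℝ, 0 < a ∧ (∀ v : Fin m → ℝ, a * ‖v‖ ≤ ‖T *ᵥ v‖) ∧ (∀ v : Fin m → ℝ, ‖T *ᵥ v‖ ≤ 2 ^ W * a * ‖v‖) := by
  classical
  have hmpos : (0 : ℝ) < m := by exact_mod_cast hm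
  have hdetpos : 0 < |T.det| := by
    by_contra h0
    have h0' : |T.det| = 0 := le_antisymm (not_lt.mp h0) (abs_nonneg _)
    rw [h0', mul_zero] at hdet
    have : (0 : ℝ) < 2 * (m : ℝ) ^ 2 * m.factorial * 2 ^ m := by positivity
    linarith
  have hadj : ∀ i j, |T.adjugate i j| ≤ (m.factorial : ℝ) * 2 ^ m := by
    intro i j
    rw [Matrix.adjugate_apply]
    have key := Matrix.det_le (A := T.updateRow j (Pi.single i 1)) (abv := AbsoluteValue.abs) (x := (2 : ℝ))
      (fun i' j' => by
        rw [AbsoluteValue.abs_apply, Matrix.updateRow_apply]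
        split_ifs
        · simp only [Pi.single_apply]
          split_ifs <;> norm_num
        · exact hT i' j')
    simpa [nsmul_eq_mul, Fintype.card_fin] using key
  set A : ℝ := (m.factorial : ℝ) * 2 ^ m with hA
  have hApos : 0 < A := by positivity
  set a : ℝ := |T.det| / ((m : ℝ) * A) with ha
  have hapos : 0 < a := by positivity
  refine ⟨a, hapos, fun v => ?_, fun v => ?_⟩
  · have hid : T.adjugate *ᵥ (T *ᵥ v) = T.det • v := by
      rw [Matrix.mulVec_mulVec, Matrix.adjugate_mul, Matrix.smul_mulVec, Matrix.one_mulVec]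
    have h1 : |T.det| * ‖v‖ = ‖T.adjugate *ᵥ (T *ᵥ v)‖ := by rw [hid, norm_smul, Real.norm_eq_abs]
    have h2 : ‖T.adjugate *ᵥ (T *ᵥ v)‖ ≤ (m : ℝ) * A * ‖T *ᵥ v‖ := norm_mulVec_le_of_entry_le _ hApos.le hadj _
    rw [ha, div_mul_eq_mul_div, div_le_iff₀ (by positivity)]
    calc |T.det| * ‖v‖ = ‖T.adjugate *ᵥ (T *ᵥ v)‖ := h1
      _ ≤ (m : ℝ) * A * ‖T *ᵥ v‖ := h2
      _ = ‖T *ᵥ v‖ * ((m : ℝ) * A) := by ring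
  · have h1 : ‖T *ᵥ v‖ ≤ (m : ℝ) * 2 * ‖v‖ := norm_mulVec_le_of_entry_le _ (by norm_num) hT _
    refine h1.trans (mul_le_mul_of_nonneg_right ?_ (norm_nonneg _))
    rw [ha, mul_div_assoc', le_div_iff₀ (by positivity)]
    calc (m : ℝ) * 2 * ((m : ℝ) * A) = 2 * (m : ℝ) ^ 2 * m.factorial * 2 ^ m := by rw [hA]; ring
      _ ≤ 2 ^ W * |T.det| := hdet

/-- the exponent bookkeeping: `W = m(P + ⌊log₂ m⌋ + 8)` conditioning bits pay for the grid loss. [folklore] -/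
theorem condPert_arith (m P : ℕ) (hm : 0 < m) :
    2 * (m : ℝ) ^ 2 * m.factorial * 2 ^ m ≤
      2 ^ (m * (P + Nat.log 2 m + 8)) * ((((m : ℝ) * 2 ^ P)⁻¹) ^ m * ((m.factorial : ℝ) / 2 ^ m)) := by
  set L := Nat.log 2 m with hL
  have key : 2 * m ^ 2 * 4 ^ m * (m * 2 ^ P) ^ m ≤ 2 ^ (m * (P + L + 8)) := by
    have hmL : m ≤ 2 * 2 ^ L := by
      have := Nat.lt_pow_succ_log_self (b := 2) (by norm_num) m
      rw [← hL, pow_succ] at this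
      omega
    have h32 : 2 * m ^ 2 ≤ 32 ^ m := by
      have h1 : m < 2 ^ m := Nat.lt_two_pow_self
      have h2 : m ^ 2 ≤ (2 ^ m) ^ 2 := Nat.pow_le_pow_left h1.le 2
      have h3 : 2 ≤ 8 ^ m :=
        calc 2 ≤ 8 ^ 1 := by norm_num
          _ ≤ 8 ^ m := Nat.pow_le_pow_right (by norm_num) hm
      have h4 : (2 ^ m) ^ 2 = 4 ^ m := by rw [← pow_mul, mul_comm, pow_mul]; norm_num
      calc 2 * m ^ 2 ≤ 8 ^ m * (2 ^ m) ^ 2 := Nat.mul_le_mul h3 h2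
        _ = 32 ^ m := by rw [h4, ← mul_pow]; norm_num
    have h28 : 2 ^ (P + L + 8) = 256 * 2 ^ L * 2 ^ P := by rw [pow_add, pow_add]; ring
    calc 2 * m ^ 2 * 4 ^ m * (m * 2 ^ P) ^ m = 2 * m ^ 2 * (4 * m * 2 ^ P) ^ m := by rw [mul_pow, mul_pow, mul_pow]; ring
      _ ≤ 32 ^ m * (4 * m * 2 ^ P) ^ m := Nat.mul_le_mul_right _ h32
      _ = (32 * (4 * m * 2 ^ P)) ^ m := by rw [← mul_pow]
      _ ≤ (256 * 2 ^ L * 2 ^ P) ^ m := Nat.pow_le_pow_left (by nlinarith [hmL, Nat.one_le_two_pow (n := P)]) m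
      _ = 2 ^ (m * (P + L + 8)) := by rw [pow_mul', h28]
  have keyR : (2 * (m : ℝ) ^ 2 * 4 ^ m * ((m : ℝ) * 2 ^ P) ^ m) ≤ (2 : ℝ) ^ (m * (P + L + 8)) := by exact_mod_cast key
  have hrhs : (2 : ℝ) ^ (m * (P + L + 8)) * ((((m : ℝ) * 2 ^ P)⁻¹) ^ m * ((m.factorial : ℝ) / 2 ^ m)) =
      (2 : ℝ) ^ (m * (P + L + 8)) * m.factorial / (((m : ℝ) * 2 ^ P) ^ m * 2 ^ m) := by
    rw [inv_pow]
    ring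
  rw [hrhs, le_div_iff₀ (by positivity)]
  calc 2 * (m : ℝ) ^ 2 * m.factorial * 2 ^ m * (((m : ℝ) * 2 ^ P) ^ m * 2 ^ m)
      = (m.factorial : ℝ) * (2 * (m : ℝ) ^ 2 * 4 ^ m * ((m : ℝ) * 2 ^ P) ^ m) := by
        rw [show (4 : ℝ) ^ m = 2 ^ m * 2 ^ m by rw [← mul_pow]; norm_num]
        ring
    _ ≤ (m.factorial : ℝ) * (2 : ℝ) ^ (m * (P + L + 8)) := mul_le_mul_of_nonneg_left keyR (by positivity)
    _ = (2 : ℝ) ^ (m * (P + L + 8)) * m.factorial := by ring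

/-- `(Σ_l c_l • S_l) v = Σ_l c_l • (S_l v)` (local copy; the NormEra file carries the same identity). [folklore] -/
private theorem sum_smul_mulVec_cp {m K : ℕ} (c : Fin K → ℝ) (S : Fin K → Matrix (Fin m) (Fin m) ℝ) (v : Fin m → ℝ) :
    (∑ l, c l • S l) *ᵥ v = ∑ l, c l • (S l *ᵥ v) := by
  rw [Matrix.sum_mulVec]
  refine Finset.sum_congr rfl fun l _ => ?_
  rw [Matrix.smul_mulVec]

/-- **top-exponent domination**: with injective exponents and two-sided norm certificates on every letter, the pencil matrix is
invertible at a large real point, so the pencil determinant is a nonzero polynomial. [folklore] -/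
theorem pencilDet_ne_zero_of_condCert {m K : ℕ} (hK : 0 < K) (d : Fin K → ℕ) (S : Fin K → Matrix (Fin m) (Fin m) ℝ)
    (hd : Function.Injective d) (a : Fin K → ℝ) (ha : ∀ l, 0 < a l) (B : ℝ)
    (hlo : ∀ l (v : Fin m → ℝ), a l * ‖v‖ ≤ ‖S l *ᵥ v‖) (hup : ∀ l (v : Fin m → ℝ), ‖S l *ᵥ v‖ ≤ B * a l * ‖v‖) :
    pencilDet d S ≠ 0 := by
  classical
  haveI : Nonempty (Fin K) := ⟨⟨0, hK⟩⟩
  obtain ⟨i, -, hi⟩ := Finset.exists_max_image univ d univ_nonempty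
  set B' : ℝ := max B 0 with hB'
  have hB'0 : 0 ≤ B' := le_max_right _ _
  have hup' : ∀ l (v : Fin m → ℝ), ‖S l *ᵥ v‖ ≤ B' * a l * ‖v‖ := fun l v =>
    (hup l v).trans (mul_le_mul_of_nonneg_right (mul_le_mul_of_nonneg_right (le_max_left _ _) (ha l).le) (norm_nonneg _))
  set x : ℝ := 1 + (∑ l, B' * a l) / a i with hx
  have hsum0 : 0 ≤ ∑ l, B' * a l := Finset.sum_nonneg fun l _ => mul_nonneg hB'0 (ha l).le
  have hx1 : 1 ≤ x := by rw [hx]; exact le_add_of_nonneg_right (div_nonneg hsum0 (ha i).le)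
  have hxpos : 0 < x := one_pos.trans_le hx1
  have hxsum : (x - 1) * a i = ∑ l, B' * a l := by
    rw [hx, add_sub_cancel_left, div_mul_cancel₀ _ (ha i).ne']
  intro hp
  have hdet : Matrix.det (∑ l, x ^ d l • S l) = 0 := by
    have := eval_pencilDet d S x
    rw [hp, eval_zero] at this
    exact this.symm
  obtain ⟨v, hv0, hv⟩ := Matrix.exists_mulVec_eq_zero_iff.2 hdet
  have hvpos : 0 < ‖v‖ := norm_pos_iff.2 hv0
  rw [sum_smul_mulVec_cp] at hv
  have hsplit := Finset.add_sum_erase univ (fun l => x ^ d l • (S l *ᵥ v)) (mem_univ i)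
  rw [hv] at hsplit
  have hiso : x ^ d i • (S i *ᵥ v) = -∑ l ∈ univ.erase i, x ^ d l • (S l *ᵥ v) := by
    rw [eq_neg_iff_add_eq_zero]; exact hsplit
  have hleft : x ^ d i * (a i * ‖v‖) ≤ ‖x ^ d i • (S i *ᵥ v)‖ := by
    rw [norm_smul, norm_pow, Real.norm_eq_abs, abs_of_pos hxpos]
    exact mul_le_mul_of_nonneg_left (hlo i v) (pow_nonneg hxpos.le _)
  have hright : x * ‖x ^ d i • (S i *ᵥ v)‖ ≤ x ^ d i * ((x - 1) * a i * ‖v‖) := by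
    rw [hiso, norm_neg]
    calc x * ‖∑ l ∈ univ.erase i, x ^ d l • (S l *ᵥ v)‖
        ≤ x * ∑ l ∈ univ.erase i, ‖x ^ d l • (S l *ᵥ v)‖ := mul_le_mul_of_nonneg_left (norm_sum_le _ _) hxpos.le
      _ = ∑ l ∈ univ.erase i, x * ‖x ^ d l • (S l *ᵥ v)‖ := Finset.mul_sum _ _ _
      _ ≤ ∑ l ∈ univ.erase i, x ^ d i * (B' * a l * ‖v‖) := Finset.sum_le_sum fun l hl => by
          have hli : l ≠ i := (mem_erase.1 hl).1
          have hdl : d l + 1 ≤ d i := by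
            have h1 : d l ≤ d i := hi l (mem_univ l)
            have h2 : d l ≠ d i := fun h => hli (hd h)
            omega
          rw [norm_smul, norm_pow, Real.norm_eq_abs, abs_of_pos hxpos]
          calc x * (x ^ d l * ‖S l *ᵥ v‖) = x ^ (d l + 1) * ‖S l *ᵥ v‖ := by ring
            _ ≤ x ^ d i * (B' * a l * ‖v‖) :=
                mul_le_mul (pow_le_pow_right₀ hx1 hdl) (hup' l v) (norm_nonneg _) (pow_nonneg hxpos.le _)
      _ = x ^ d i * ((∑ l ∈ univ.erase i, B' * a l) * ‖v‖) := by rw [Finset.sum_mul, Finset.mul_sum]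
      _ ≤ x ^ d i * ((∑ l, B' * a l) * ‖v‖) := by
          refine mul_le_mul_of_nonneg_left (mul_le_mul_of_nonneg_right ?_ hvpos.le) (pow_nonneg hxpos.le _)
          exact Finset.sum_le_sum_of_subset_of_nonneg (erase_subset _ _) fun l _ _ => mul_nonneg hB'0 (ha l).le
      _ = x ^ d i * ((x - 1) * a i * ‖v‖) := by rw [hxsum]
  have hprod : 0 < x ^ d i * (a i * ‖v‖) := mul_pos (pow_pos hxpos _) (mul_pos (ha i) hvpos)
  have hchain : x * (x ^ d i * (a i * ‖v‖)) ≤ x ^ d i * ((x - 1) * a i * ‖v‖) :=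
    (mul_le_mul_of_nonneg_left hleft hxpos.le).trans hright
  nlinarith [hprod, hchain]

/-- **CONDITIONED PERTURBATION** (statement of stub R2 `ConditionedPerturbation` of line «conditioning», with `IsEntryScale` and `CondLE`
unfolded): a symmetric letter tuple with entry scales `ρ_l` has a symmetric perturbation of entrywise size `≤ 2^{-P} ρ_l` whose letters are
`2^{m(P + ⌊log₂ m⌋ + 8)}`-conditioned for the sup norm and whose pencil determinant is a nonzero polynomial. [this file] -/
theorem conditionedPerturbation (m K P : ℕ) (d : Fin K → ℕ) (S : Fin K → Matrix (Fin m) (Fin m) ℝ) (ρ : Fin K → ℝ)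
    (hK : 0 < K) (hd : Function.Injective d) (hS : ∀ l, (S l).IsSymm) (hρ : ∀ l, 0 < ρ l)
    (hsc : ∀ l, (∀ i j, |S l i j| ≤ ρ l) ∧ ∃ i j, ρ l ≤ |S l i j|) :
    ∃ S' : Fin K → Matrix (Fin m) (Fin m) ℝ, (∀ l, (S' l).IsSymm) ∧ (∀ l i j, (2 : ℝ) ^ P * |S' l i j - S l i j| ≤ ρ l) ∧
      (∀ l, ∃ a : ℝ, 0 < a ∧ (∀ v : Fin m → ℝ, a * ‖v‖ ≤ ‖S' l *ᵥ v‖) ∧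
        (∀ v : Fin m → ℝ, ‖S' l *ᵥ v‖ ≤ 2 ^ (m * (P + Nat.log 2 m + 8)) * a * ‖v‖)) ∧
      pencilDet d S' ≠ 0 := by
  classical
  have hm : 0 < m := by
    rcases Nat.eq_zero_or_pos m with h0 | h0
    · exfalso
      subst h0
      obtain ⟨i, -, -⟩ := (hsc ⟨0, hK⟩).2
      exact i.elim0
    · exact h0
  -- normalised letters `T_l = S_l / ρ_l`, entries `≤ 1`
  set T : Fin K → Matrix (Fin m) (Fin m) ℝ := fun l => (ρ l)⁻¹ • S l with hT
  have hT1 : ∀ l i j, |T l i j| ≤ 1 := by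
    intro l i j
    simp only [hT, Matrix.smul_apply, smul_eq_mul]
    rw [abs_mul, abs_inv, abs_of_pos (hρ l), inv_mul_le_iff₀ (hρ l), mul_one]
    exact (hsc l).1 i j
  choose ε hε0 hε1 hdet using fun l => exists_shift_det_ge hm P (T l)
  set W := m * (P + Nat.log 2 m + 8) with hW
  set S' : Fin K → Matrix (Fin m) (Fin m) ℝ := fun l => S l + (ε l * ρ l) • (1 : Matrix (Fin m) (Fin m) ℝ) with hS'
  have hscale : ∀ l, S' l = ρ l • (T l + ε l • (1 : Matrix (Fin m) (Fin m) ℝ)) := by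
    intro l
    ext i j
    simp only [hS', hT, Matrix.add_apply, Matrix.smul_apply, Matrix.one_apply, smul_eq_mul]
    have hρne : ρ l ≠ 0 := (hρ l).ne'
    split_ifs <;> field_simp
  -- conditioning certificates for every perturbed letter
  have hcert : ∀ l, ∃ a : ℝ, 0 < a ∧ (∀ v : Fin m → ℝ, a * ‖v‖ ≤ ‖S' l *ᵥ v‖) ∧
      (∀ v : Fin m → ℝ, ‖S' l *ᵥ v‖ ≤ 2 ^ W * a * ‖v‖) := by
    intro l
    have hε1' : ε l ≤ 1 := by
      have : (1 : ℝ) ≤ 2 ^ P := one_le_pow₀ (by norm_num)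
      nlinarith [hε0 l, hε1 l]
    have hT' : ∀ i j, |(T l + ε l • (1 : Matrix (Fin m) (Fin m) ℝ)) i j| ≤ 2 := by
      intro i j
      simp only [Matrix.add_apply, Matrix.smul_apply, Matrix.one_apply, smul_eq_mul]
      split_ifs
      · calc |T l i j + ε l * 1| ≤ |T l i j| + |ε l * 1| := abs_add_le _ _
          _ ≤ 1 + 1 := add_le_add (hT1 l i j) (by rw [mul_one, abs_of_nonneg (hε0 l)]; exact hε1')
          _ = 2 := by norm_num
      · rw [mul_zero, add_zero]
        exact (hT1 l i j).trans (by norm_num)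
    have hdetW : 2 * (m : ℝ) ^ 2 * m.factorial * 2 ^ m ≤ 2 ^ W * |(T l + ε l • (1 : Matrix (Fin m) (Fin m) ℝ)).det| :=
      (condPert_arith m P hm).trans (mul_le_mul_of_nonneg_left (hdet l) (by positivity))
    obtain ⟨a, ha, hlo, hup⟩ := condCert_of_det_ge hm _ hT' W hdetW
    refine ⟨ρ l * a, mul_pos (hρ l) ha, fun v => ?_, fun v => ?_⟩
    · rw [hscale l, Matrix.smul_mulVec, norm_smul, Real.norm_eq_abs, abs_of_pos (hρ l), mul_assoc]
      exact mul_le_mul_of_nonneg_left (hlo v) (hρ l).le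
    · rw [hscale l, Matrix.smul_mulVec, norm_smul, Real.norm_eq_abs, abs_of_pos (hρ l)]
      calc ρ l * ‖(T l + ε l • (1 : Matrix (Fin m) (Fin m) ℝ)) *ᵥ v‖ ≤ ρ l * (2 ^ W * a * ‖v‖) :=
            mul_le_mul_of_nonneg_left (hup v) (hρ l).le
        _ = 2 ^ W * (ρ l * a) * ‖v‖ := by ring
  refine ⟨S', fun l => ?_, fun l i j => ?_, hcert, ?_⟩
  · -- symmetry
    have h := hS l
    unfold Matrix.IsSymm at h ⊢
    simp only [hS']
    rw [Matrix.transpose_add, Matrix.transpose_smul, Matrix.transpose_one, h]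
  · -- entrywise size of the perturbation
    simp only [hS', Matrix.add_apply, Matrix.smul_apply, Matrix.one_apply, smul_eq_mul, add_sub_cancel_left]
    split_ifs
    · rw [mul_one, abs_mul, abs_of_nonneg (hε0 l), abs_of_pos (hρ l), ← mul_assoc]
      calc (2 : ℝ) ^ P * ε l * ρ l ≤ 1 * ρ l := mul_le_mul_of_nonneg_right (hε1 l) (hρ l).le
        _ = ρ l := one_mul _
    · rw [mul_zero, abs_zero, mul_zero]
      exact (hρ l).le
  · -- the determinant polynomial does not vanish
    choose a ha hlo hup using hcert
    exact pencilDet_ne_zero_of_condCert hK d S' hd a ha (2 ^ W) hlo hup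

end ConditionedPerturbation

end Summit.ValiantsHypothesis.ValiantsHypothesis.Theorems.KPlusLogSqLaw.Octave
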